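import Literature.NumberTheory.EllipticCurves.HasseWeilAbelianInertiaInvariants
import Literature.NumberTheory.EllipticCurves.HasseWeilAbelianConductorProofs
import Literature.NumberTheory.EllipticCurves.SingularCubic
import Literature.NumberTheory.EllipticCurves.TateModuleRank
import Literature.NumberTheory.EllipticCurves.TateModuleFinite
import Literature.NumberTheory.EllipticCurves.TateModuleFinrankProofs
import Literature.NumberTheory.EllipticCurves.HasseWeilGoodReductionFrobenius
import Literature.NumberTheory.DiophantineGeometry.TateAlgorithmOrdDiscriminant
import Literature.NumberTheory.DiophantineGeometry.TateAlgorithmProofs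
import Mathlib.RingTheory.RootsOfUnity.AlgebraicallyClosed
import HarnessLib

/-!
# Silverman *ATAEC* Thm. IV.10.2(a) at the bad places from the fundamental isomorphism (proofs)

Sibling proof file (theorems only) of `HasseWeilAbelianInertiaInvariants`.  From the named fact
`WeierstrassCurve.nonempty_fixedSubmodule_inertia_rationalTate_equiv_reductionPoints` vendored
there — Serre–Tate's fundamental isomorphism `(V_ℓ E)^{I_𝔓} ≅ V_ℓ(Ẽ_ns(k̄_v))` (Silverman,
*ATAEC*, proof of Thm. IV.10.2(a), PDF p. 359), taken as the hypothesis `hST` — this file proves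
the two bad-place cases of Thm. IV.10.2(a) vendored as named facts in `HasseWeilAbelianConductor`:

* `codimFixed_inertia_rationalTate_eq_two_of_hasAdditiveReductionAt_of_serreTate`:
  additive reduction at `v ∤ ℓ` ⟹ `codim (V_ℓ E)^{I_𝔓} = 2`;
* `codimFixed_inertia_rationalTate_eq_one_of_hasMultiplicativeReductionAt_of_serreTate`:
  multiplicative reduction at `v ∤ ℓ` ⟹ `codim (V_ℓ E)^{I_𝔓} = 1`,

and then the assemblies with `HasseWeilAbelianConductorProofs`: Thm. IV.10.2(a) itself
(`codimFixed_inertia_rationalTate_eq_tameConductorExponent_of_serreTate`, the good places being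
*AEC* VII.4.1(b)), the C15 fact `artinConductorExponent_tate_eq_conductorExponent_of_isElliptic`
from `hST` and the two wild-part facts (`…_of_serreTate_of_wild`, resp. `…_of_wild'` with Ogg–Saito
confined to residue characteristics `2, 3`), and the semistable case from `hST` and tameness at
the multiplicative places (`…_of_isSemistable_of_serreTate`).  The two bad-place cases are proved
exactly as printed (p. 359): `ε(E/K) = 2 - dim V_ℓ(E)^{I} = 2 - dim V_ℓ(Ẽ_ns(k̄))`, and
`V_ℓ(k̄⁺) = 0`, `V_ℓ(k̄^*) ≅ ℚ_ℓ` "using the fact that `ℓ ≠ p`", the structure of `Ẽ_ns(k̄)`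
(`≅ k̄⁺` for a cusp, `≅ k̄^*` for a node, *AEC* III.2.5 = VII.5.1) being the tree's theorems
`WeierstrassCurve.nonempty_point_addEquiv_of_cusp` / `nonempty_point_addEquiv_units_of_node`
(`SingularCubic`), the passage from torsion counts `#A[ℓⁿ] = ℓ^{dn}` to `dim V_ℓ(A) = d` being
`Literature.NumberTheory.EllipticCurves.RationalTateModule.finrank_eq_of_card_torsionBy` (`TateModuleRank`), and `dim V_ℓ E = 2`
being `finrank_rationalTateModule_eq_two_holds` (*AEC* III.7.1).

Intermediate results (all proved): transport of `#A[n]` along `A ≃+ B`; `#k[n] = 1` for the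
additive group of a field with `n ≠ 0` in `k`; hence `dim V_ℓ(k⁺) = 0`
and, for `k` separably closed with `ℓ ≠ 0` in `k`, `dim V_ℓ(k^*) = 1` (Mathlib
`HasEnoughRootsOfUnity.natCard_rootsOfUnity`); `dim V_ℓ(Ẽ_ns(k̄)) = 0` (cusp) / `= 1` (node)
for a singular Weierstrass cubic over an algebraically closed field; the reduction `Ẽ_v ⊗ k̄_v`
(`reductionAlgClosure`) of a curve with additive (resp. multiplicative) reduction at `v` has
`Δ = 0 = c₄` (resp. `Δ = 0 ≠ c₄`), and `ℓ ≠ 0` in `k̄_v` for `v ∤ ℓ`.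

## References

* J. H. Silverman, *Advanced Topics in the Arithmetic of Elliptic Curves*, GTM 151 (1994), proof
  of Thm. IV.10.2(a), PDF p. 359. [SilvermanATAEC1994]
* J. H. Silverman, *The Arithmetic of Elliptic Curves*, 2nd ed. (2009), III.2.5, III.7.1,
  VII.5.1. [SilvermanAEC2009]
* J.-P. Serre, J. Tate, *Good reduction of abelian varieties*, Ann. of Math. 88 (1968), §1.
  [SerreTate1968]

## Design

No definitions, no `sorry`; `noncomputable section`, `open scoped Classical`; one universe `u`.
-/

noncomputable section

open scoped Classical NumberField AddSubgroup
open Field IsDedekindDomain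

universe u

/-! ### Torsion counts and dimensions of Tate modules of `k⁺` and `k^*` -/

namespace Literature.NumberTheory.EllipticCurves

section Transport

variable {A : Type*} [AddCommGroup A] {B : Type*} [AddCommGroup B]

/-- `#A[n] = #B[n]` for isomorphic abelian groups. [folklore] -/
theorem natCard_torsionBy_eq_of_addEquiv (e : A ≃+ B) (n : ℕ) :
    Nat.card (A[(n : ℕ)]) = Nat.card (B[(n : ℕ)]) := by
  refine Nat.card_congr (e.toEquiv.subtypeEquiv fun a ↦ ?_)
  change a ∈ A[(n : ℕ)] ↔ e a ∈ B[(n : ℕ)]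
  rw [AddSubgroup.torsionBy.nsmul_iff, AddSubgroup.torsionBy.nsmul_iff, ← map_nsmul,
    e.map_eq_zero_iff]

end Transport

section Field

variable (k : Type*) [Field k]

/-- The additive group of a field has no `n`-torsion when `n ≠ 0` in `k`: `#k⁺[n] = 1`.
(Silverman, *ATAEC*, proof of IV.10.2(a): "`V_ℓ(k̄⁺) = 0`", using `ℓ ≠ p`.) [folklore] -/
theorem natCard_torsionBy_eq_one_of_natCast_ne_zero {n : ℕ} (hn : (n : k) ≠ 0) :
    Nat.card (k[(n : ℕ)]) = 1 := by
  have h : k[(n : ℕ)] = ⊥ := by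
    refine (AddSubgroup.eq_bot_iff_forall _).mpr fun x hx ↦ ?_
    rw [AddSubgroup.torsionBy.nsmul_iff, nsmul_eq_mul] at hx
    exact (mul_eq_zero.mp hx).resolve_left hn
  rw [h, AddSubgroup.card_bot]

variable (ℓ : ℕ) [Fact ℓ.Prime]

/-- `dim_{ℚ_ℓ} V_ℓ(k⁺) = 0` when `ℓ ≠ 0` in `k` (Silverman, *ATAEC*, proof of IV.10.2(a), PDF
p. 359: "`V_ℓ(k̄⁺) = 0`"). [cite: SilvermanATAEC1994, proof of Thm. IV.10.2(a) (PDF p. 359)] -/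
theorem RationalTateModule.finrank_field_eq_zero (hℓ : (ℓ : k) ≠ 0) :
    Module.finrank ℚ_[ℓ] (RationalTateModule k ℓ) = 0 := by
  refine RationalTateModule.finrank_eq_of_card_torsionBy (d := 0) fun n ↦ ?_
  rw [zero_mul, pow_zero]
  exact natCard_torsionBy_eq_one_of_natCast_ne_zero k (by exact_mod_cast pow_ne_zero n hℓ)

/-- `dim_{ℚ_ℓ} V_ℓ(k^*) = 1` for a separably closed field `k` with `ℓ ≠ 0` in `k`:
`#μ_{ℓⁿ}(k) = ℓⁿ` (Mathlib `HasEnoughRootsOfUnity.natCard_rootsOfUnity`).  (Silverman, *ATAEC*,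
proof of IV.10.2(a), PDF p. 359: "`V_ℓ(k̄^*) ≅ ℚ_ℓ`".)
[cite: SilvermanATAEC1994, proof of Thm. IV.10.2(a) (PDF p. 359)] -/
theorem RationalTateModule.finrank_additive_units_eq_one [IsSepClosed k] (hℓ : (ℓ : k) ≠ 0) :
    Module.finrank ℚ_[ℓ] (RationalTateModule (Additive kˣ) ℓ) = 1 := by
  haveI : NeZero (ℓ : k) := ⟨hℓ⟩
  refine RationalTateModule.finrank_eq_of_card_torsionBy (d := 1) fun n ↦ ?_
  haveI : NeZero (ℓ ^ n) := ⟨pow_ne_zero n (Fact.out : ℓ.Prime).ne_zero⟩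
  -- `(k^*)[ℓⁿ]`, written additively, is `μ_{ℓⁿ}(k)`, of order `ℓⁿ`
  have hc : Nat.card ((Additive kˣ)[(ℓ ^ n : ℕ)]) = Nat.card (rootsOfUnity (ℓ ^ n) k) := by
    refine Nat.card_congr (Additive.toMul.subtypeEquiv fun x ↦ ?_)
    change x ∈ (Additive kˣ)[(ℓ ^ n : ℕ)] ↔ Additive.toMul x ∈ rootsOfUnity (ℓ ^ n) k
    rw [AddSubgroup.torsionBy.nsmul_iff, mem_rootsOfUnity, ← toMul_nsmul, ← toMul_zero,
      Additive.toMul.apply_eq_iff_eq]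
  rw [one_mul, hc]
  exact HasEnoughRootsOfUnity.natCard_rootsOfUnity k (ℓ ^ n)

end Field

end Literature.NumberTheory.EllipticCurves

namespace WeierstrassCurve

open Literature.NumberTheory.EllipticCurves Literature.NumberTheory.GaloisRepresentations

/-! ### `dim V_ℓ(Ẽ_ns(k̄))` for a singular cubic over an algebraically closed field -/

section Singular

variable {k : Type u} [Field k] [IsAlgClosed k] (V : WeierstrassCurve k) (ℓ : ℕ) [Fact ℓ.Prime]

/-- For a cuspidal Weierstrass cubic `V` (`Δ = 0 = c₄`) over an algebraically closed field in
which `ℓ ≠ 0`, `dim_{ℚ_ℓ} V_ℓ(V_ns(k)) = 0`: `V_ns(k) ≅ k⁺` (*AEC* III.2.5(b),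
`nonempty_point_addEquiv_of_cusp`) has no `ℓ`-torsion.  Silverman, *ATAEC*, proof of
Thm. IV.10.2(a), additive case (PDF p. 359).
[cite: SilvermanATAEC1994, proof of Thm. IV.10.2(a) (PDF p. 359)] -/
theorem finrank_rationalTateModule_point_eq_zero_of_cusp (hΔ : V.Δ = 0) (hc₄ : V.c₄ = 0)
    (hℓ : (ℓ : k) ≠ 0) :
    Module.finrank ℚ_[ℓ] (RationalTateModule V.toAffine.Point ℓ) = 0 := by
  obtain ⟨e⟩ := V.nonempty_point_addEquiv_of_cusp hΔ hc₄
  refine RationalTateModule.finrank_eq_of_card_torsionBy (d := 0) fun n ↦ ?_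
  rw [natCard_torsionBy_eq_of_addEquiv e, zero_mul, pow_zero]
  exact natCard_torsionBy_eq_one_of_natCast_ne_zero k (by exact_mod_cast pow_ne_zero n hℓ)

/-- For a nodal Weierstrass cubic `V` (`Δ = 0 ≠ c₄`) over an algebraically closed field in which
`ℓ ≠ 0`, `dim_{ℚ_ℓ} V_ℓ(V_ns(k)) = 1`: `V_ns(k) ≅ k^*` (*AEC* III.2.5(a),
`nonempty_point_addEquiv_units_of_node`) and `#μ_{ℓⁿ}(k) = ℓⁿ`.  Silverman, *ATAEC*, proof of
Thm. IV.10.2(a), multiplicative case (PDF p. 359).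
[cite: SilvermanATAEC1994, proof of Thm. IV.10.2(a) (PDF p. 359)] -/
theorem finrank_rationalTateModule_point_eq_one_of_node (hΔ : V.Δ = 0) (hc₄ : V.c₄ ≠ 0)
    (hℓ : (ℓ : k) ≠ 0) :
    Module.finrank ℚ_[ℓ] (RationalTateModule V.toAffine.Point ℓ) = 1 := by
  obtain ⟨e⟩ := V.nonempty_point_addEquiv_units_of_node hΔ hc₄
  haveI : NeZero (ℓ : k) := ⟨hℓ⟩
  refine RationalTateModule.finrank_eq_of_card_torsionBy (d := 1) fun n ↦ ?_
  haveI : NeZero (ℓ ^ n) := ⟨pow_ne_zero n (Fact.out : ℓ.Prime).ne_zero⟩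
  -- `(k^*)[ℓⁿ]`, written additively, is `μ_{ℓⁿ}(k)`, of order `ℓⁿ`
  have hc : Nat.card ((Additive kˣ)[(ℓ ^ n : ℕ)]) = Nat.card (rootsOfUnity (ℓ ^ n) k) := by
    refine Nat.card_congr (Additive.toMul.subtypeEquiv fun x ↦ ?_)
    change x ∈ (Additive kˣ)[(ℓ ^ n : ℕ)] ↔ Additive.toMul x ∈ rootsOfUnity (ℓ ^ n) k
    rw [AddSubgroup.torsionBy.nsmul_iff, mem_rootsOfUnity, ← toMul_nsmul, ← toMul_zero,
      Additive.toMul.apply_eq_iff_eq]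
  rw [natCard_torsionBy_eq_of_addEquiv e, one_mul, hc]
  exact HasEnoughRootsOfUnity.natCard_rootsOfUnity k (ℓ ^ n)

end Singular

/-! ### The reduction `Ẽ_v ⊗ k̄_v` at a bad place -/

section Reduction

variable {K : Type u} [Field K] [NumberField K] (W : WeierstrassCurve K)

/-- At a place of additive reduction the reduced minimal model is cuspidal: `Δ(Ẽ_v) = 0` and
`c₄(Ẽ_v) = 0` (Mathlib `HasAdditiveReduction`: `v(Δ_min) > 0`, `v(c₄) > 0`; tree
`hasAdditiveReductionAt_iff_mem`).  Silverman, *AEC* VII.5.1(c). [folklore] -/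
theorem reductionAlgClosure_Δ_eq_zero_and_c₄_eq_zero_of_hasAdditiveReductionAt
    {v : HeightOneSpectrum (𝓞 K)} (hv : W.HasAdditiveReductionAt v) :
    (W.reductionAlgClosure v).Δ = 0 ∧ (W.reductionAlgClosure v).c₄ = 0 := by
  obtain ⟨hΔ, hc₄⟩ := (hasAdditiveReductionAt_iff_mem v W).mp hv
  rw [reductionAlgClosure_Δ, reductionAlgClosure_c₄, (IsLocalRing.residue_eq_zero_iff _).mpr hΔ,
    (IsLocalRing.residue_eq_zero_iff _).mpr hc₄, map_zero]
  exact ⟨rfl, rfl⟩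

/-- At a place of multiplicative reduction the reduced minimal model is nodal: `Δ(Ẽ_v) = 0` and
`c₄(Ẽ_v) ≠ 0` (Mathlib `HasMultiplicativeReduction`: `v(Δ_min) > 0`, `v(c₄) = 0`; tree
`hasMultiplicativeReductionAt_iff_mem`).  Silverman, *AEC* VII.5.1(b). [folklore] -/
theorem reductionAlgClosure_Δ_eq_zero_and_c₄_ne_zero_of_hasMultiplicativeReductionAt
    {v : HeightOneSpectrum (𝓞 K)} (hv : W.HasMultiplicativeReductionAt v) :
    (W.reductionAlgClosure v).Δ = 0 ∧ (W.reductionAlgClosure v).c₄ ≠ 0 := by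
  obtain ⟨hΔ, hc₄⟩ := (hasMultiplicativeReductionAt_iff_mem v W).mp hv
  rw [reductionAlgClosure_Δ, reductionAlgClosure_c₄, (IsLocalRing.residue_eq_zero_iff _).mpr hΔ,
    map_zero]
  set k := IsLocalRing.ResidueField (v.adicCompletionIntegers K)
  have hinj : Function.Injective (algebraMap k (AlgebraicClosure k)) :=
    (algebraMap k (AlgebraicClosure k)).injective
  exact ⟨rfl, (map_ne_zero_iff _ hinj).mpr fun h0 ↦
    hc₄ ((IsLocalRing.residue_eq_zero_iff _).mp h0)⟩

/-- If `v ∤ ℓ` then `ℓ ≠ 0` in `k̄_v` (i.e. `ℓ ≠ char k_v`; `natCast_residueField_ne_zero`).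
[folklore] -/
theorem natCast_algebraicClosure_residueField_ne_zero {v : HeightOneSpectrum (𝓞 K)} {ℓ : ℕ}
    (hℓ : (ℓ : 𝓞 K) ∉ v.asIdeal) :
    (ℓ : AlgebraicClosure (IsLocalRing.ResidueField (v.adicCompletionIntegers K))) ≠ 0 := by
  set k := IsLocalRing.ResidueField (v.adicCompletionIntegers K)
  have hinj : Function.Injective (algebraMap k (AlgebraicClosure k)) :=
    (algebraMap k (AlgebraicClosure k)).injective
  rw [← map_natCast (algebraMap k (AlgebraicClosure k)) ℓ]
  exact (map_ne_zero_iff _ hinj).mpr (natCast_residueField_ne_zero hℓ)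

variable (ℓ : ℕ) [Fact ℓ.Prime]

/-- At a place `v ∤ ℓ` of additive reduction, `dim_{ℚ_ℓ} V_ℓ(Ẽ_ns(k̄_v)) = 0`
(Silverman, *ATAEC*, proof of Thm. IV.10.2(a), PDF p. 359: `V_ℓ(Ẽ_ns(k̄)) = V_ℓ(k̄⁺) = 0`).
[cite: SilvermanATAEC1994, proof of Thm. IV.10.2(a) (PDF p. 359)] -/
theorem finrank_rationalTateModule_reductionPoints_eq_zero_of_hasAdditiveReductionAt
    {v : HeightOneSpectrum (𝓞 K)} (hv : W.HasAdditiveReductionAt v) (hℓ : (ℓ : 𝓞 K) ∉ v.asIdeal) :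
    Module.finrank ℚ_[ℓ] (RationalTateModule (W.reductionAlgClosure v).toAffine.Point ℓ) = 0 := by
  obtain ⟨hΔ, hc₄⟩ := W.reductionAlgClosure_Δ_eq_zero_and_c₄_eq_zero_of_hasAdditiveReductionAt hv
  exact finrank_rationalTateModule_point_eq_zero_of_cusp _ ℓ hΔ hc₄
    (natCast_algebraicClosure_residueField_ne_zero hℓ)

/-- At a place `v ∤ ℓ` of multiplicative reduction, `dim_{ℚ_ℓ} V_ℓ(Ẽ_ns(k̄_v)) = 1`
(Silverman, *ATAEC*, proof of Thm. IV.10.2(a), PDF p. 359: `V_ℓ(Ẽ_ns(k̄)) = V_ℓ(k̄^*) ≅ ℚ_ℓ`).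
[cite: SilvermanATAEC1994, proof of Thm. IV.10.2(a) (PDF p. 359)] -/
theorem finrank_rationalTateModule_reductionPoints_eq_one_of_hasMultiplicativeReductionAt
    {v : HeightOneSpectrum (𝓞 K)} (hv : W.HasMultiplicativeReductionAt v)
    (hℓ : (ℓ : 𝓞 K) ∉ v.asIdeal) :
    Module.finrank ℚ_[ℓ] (RationalTateModule (W.reductionAlgClosure v).toAffine.Point ℓ) = 1 := by
  obtain ⟨hΔ, hc₄⟩ :=
    W.reductionAlgClosure_Δ_eq_zero_and_c₄_ne_zero_of_hasMultiplicativeReductionAt hv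
  exact finrank_rationalTateModule_point_eq_one_of_node _ ℓ hΔ hc₄
    (natCast_algebraicClosure_residueField_ne_zero hℓ)

end Reduction

/-! ### Thm. IV.10.2(a) at the bad places from the fundamental isomorphism -/

section TenTwo

variable {K : Type u} [Field K] [NumberField K] (W : WeierstrassCurve K) (ℓ : ℕ) [Fact ℓ.Prime]

/-- `codim (V_ℓ E)^{I_𝔓} = 2 - dim V_ℓ(Ẽ_ns(k̄_v))` at `v ∤ ℓ`, from the fundamental isomorphism
(`hST`) and `dim V_ℓ E = 2` (*AEC* III.7.1, `finrank_rationalTateModule_eq_two_holds`).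
Silverman, *ATAEC*, proof of Thm. IV.10.2(a), PDF p. 359:
`ε(E/K) = 2 - dim V_ℓ(E)^{I} = 2 - dim V_ℓ(Ẽ_ns(k̄))`.
[cite: SilvermanATAEC1994, proof of Thm. IV.10.2(a) (PDF p. 359)] -/
theorem codimFixed_inertia_rationalTate_eq_two_sub_of_serreTate
    (hST : W.nonempty_fixedSubmodule_inertia_rationalTate_equiv_reductionPoints ℓ) [W.IsElliptic]
    (h : Continuous fun x : absoluteGaloisGroup K × RationalTateModule (geomPoints W) ℓ ↦
      rationalTateRepresentation (absoluteGaloisGroup K) (geomPoints W) ℓ x.1 x.2)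
    (v : HeightOneSpectrum (𝓞 K)) (hℓ : (ℓ : 𝓞 K) ∉ v.asIdeal)
    {𝔓 : Ideal (absIntegers (𝓞 K) K)} (h𝔓 : 𝔓 ∈ v.primesAbove) :
    (rationalTateGaloisRepOf (geomPoints W) ℓ h).codimFixed (𝔓.inertia (absoluteGaloisGroup K)) =
      2 - Module.finrank ℚ_[ℓ] (RationalTateModule (W.reductionAlgClosure v).toAffine.Point ℓ) := by
  have hℓK : (ℓ : K) ≠ 0 := Nat.cast_ne_zero.mpr (Fact.out : ℓ.Prime).ne_zero
  haveI : Module.Finite ℚ_[ℓ] (RationalTateModule (geomPoints W) ℓ) := W.finite_rationalTateModule ℓ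
  rw [ContinuousRep.codimFixed_eq_finrank_sub,
    W.finrank_fixedSubmodule_inertia_rationalTate_eq_of_serreTate ℓ hST h v hℓ h𝔓]
  change Module.finrank ℚ_[ℓ] (W.rationalTateModule ℓ) - _ = _
  rw [finrank_rationalTateModule_eq_two_holds W ℓ hℓK]

/-- **Silverman *ATAEC* Thm. IV.10.2(a), additive case, from the fundamental isomorphism.**  The
named fact `codimFixed_inertia_rationalTate_eq_two_of_hasAdditiveReductionAt W ℓ` of
`HasseWeilAbelianConductor` (`codim (V_ℓ E)^{I_𝔓} = 2`, i.e. `(V_ℓ E)^{I_𝔓} = 0`, at a place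
`v ∤ ℓ` of additive reduction) follows from Serre–Tate's isomorphism
`(V_ℓ E)^{I_𝔓} ≅ V_ℓ(Ẽ_ns(k̄_v))` (`hST`): printed proof, PDF p. 359,
`ε = 2 - dim V_ℓ(k̄⁺) = 2 - 0`. [cite: SilvermanATAEC1994, Thm. IV.10.2(a) and its proof (PDF pp. 358–359)] -/
theorem codimFixed_inertia_rationalTate_eq_two_of_hasAdditiveReductionAt_of_serreTate
    (hST : W.nonempty_fixedSubmodule_inertia_rationalTate_equiv_reductionPoints ℓ) :
    W.codimFixed_inertia_rationalTate_eq_two_of_hasAdditiveReductionAt ℓ := by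
  intro _ h v hℓ hv 𝔓 h𝔓
  rw [W.codimFixed_inertia_rationalTate_eq_two_sub_of_serreTate ℓ hST h v hℓ h𝔓,
    W.finrank_rationalTateModule_reductionPoints_eq_zero_of_hasAdditiveReductionAt ℓ hv hℓ]

/-- **Silverman *ATAEC* Thm. IV.10.2(a), multiplicative case, from the fundamental isomorphism.**
The named fact `codimFixed_inertia_rationalTate_eq_one_of_hasMultiplicativeReductionAt W ℓ` of
`HasseWeilAbelianConductor` (`codim (V_ℓ E)^{I_𝔓} = 1` at a place `v ∤ ℓ` of multiplicative
reduction) follows from Serre–Tate's isomorphism (`hST`): printed proof, PDF p. 359,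
`ε = 2 - dim V_ℓ(k̄^*) = 2 - 1`. [cite: SilvermanATAEC1994, Thm. IV.10.2(a) and its proof (PDF pp. 358–359)] -/
theorem codimFixed_inertia_rationalTate_eq_one_of_hasMultiplicativeReductionAt_of_serreTate
    (hST : W.nonempty_fixedSubmodule_inertia_rationalTate_equiv_reductionPoints ℓ) :
    W.codimFixed_inertia_rationalTate_eq_one_of_hasMultiplicativeReductionAt ℓ := by
  intro _ h v hℓ hv 𝔓 h𝔓
  rw [W.codimFixed_inertia_rationalTate_eq_two_sub_of_serreTate ℓ hST h v hℓ h𝔓,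
    W.finrank_rationalTateModule_reductionPoints_eq_one_of_hasMultiplicativeReductionAt ℓ hv hℓ]

end TenTwo

/-! ### Assemblies: Thm. IV.10.2(a) and the C15 fact from the fundamental isomorphism -/

section Assembly

variable {K : Type u} [Field K] [NumberField K] (W : WeierstrassCurve K) (ℓ : ℕ) [Fact ℓ.Prime]

/-- **Silverman *ATAEC* Thm. IV.10.2(a) from the fundamental isomorphism.**  The named fact
`codimFixed_inertia_rationalTate_eq_tameConductorExponent W ℓ` of `HasseWeilAbelianConductor`
(`codim (V_ℓ E)^{I_𝔓} = ε_v` at every `v ∤ ℓ`) follows from Serre–Tate's isomorphism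
`(V_ℓ E)^{I_𝔓} ≅ V_ℓ(Ẽ_ns(k̄_v))` alone (`hST`): good places by *AEC* VII.4.1(b)
(`HasseWeilAbelianConductorProofs`), multiplicative and additive places by the two theorems above —
the printed proof, PDF p. 359. [cite: SilvermanATAEC1994, Thm. IV.10.2(a) and its proof (PDF pp. 358–359)] -/
theorem codimFixed_inertia_rationalTate_eq_tameConductorExponent_of_serreTate
    (hST : W.nonempty_fixedSubmodule_inertia_rationalTate_equiv_reductionPoints ℓ) :
    W.codimFixed_inertia_rationalTate_eq_tameConductorExponent ℓ :=
  W.codimFixed_inertia_rationalTate_eq_tameConductorExponent_of_mult_of_add ℓ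
    (W.codimFixed_inertia_rationalTate_eq_one_of_hasMultiplicativeReductionAt_of_serreTate ℓ hST)
    (W.codimFixed_inertia_rationalTate_eq_two_of_hasAdditiveReductionAt_of_serreTate ℓ hST)

/-- **The C15 fact from the fundamental isomorphism and the two wild-part facts.**  Ogg–Saito in
Galois form, `artinConductorExponent_tate_eq_conductorExponent_of_isElliptic W ℓ`
(`a_v(V_ℓ E) = f_v` for `v ∤ ℓ`), follows from Serre–Tate's isomorphism (`hST`, giving the tame
part, Thm. IV.10.2(a)) together with the wild-part facts of `HasseWeilAbelianConductor` at the
multiplicative places (`hWm`, Thm. IV.10.2(b)) and at the additive places (`hWa`, Ogg's formula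
IV.11.1). [cite: SilvermanATAEC1994, Thm. IV.10.2 and IV.11.1 (PDF pp. 358–366)] -/
theorem artinConductorExponent_tate_eq_conductorExponent_of_isElliptic_of_serreTate_of_wild
    (hST : W.nonempty_fixedSubmodule_inertia_rationalTate_equiv_reductionPoints ℓ)
    (hWm : W.swanConductorAt_rationalTate_eq_zero_of_hasMultiplicativeReductionAt ℓ)
    (hWa : W.swanConductorAt_rationalTate_eq_wildConductorExponent_of_hasAdditiveReductionAt ℓ) :
    W.artinConductorExponent_tate_eq_conductorExponent_of_isElliptic ℓ :=
  W.artinConductorExponent_tate_eq_conductorExponent_of_isElliptic_of_facts ℓ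
    (W.codimFixed_inertia_rationalTate_eq_one_of_hasMultiplicativeReductionAt_of_serreTate ℓ hST)
    (W.codimFixed_inertia_rationalTate_eq_two_of_hasAdditiveReductionAt_of_serreTate ℓ hST) hWm hWa

/-- The same with Ogg's formula confined to residue characteristics `2, 3`: the C15 fact from
Serre–Tate's isomorphism (`hST`), tameness at the multiplicative places (`hWm`, IV.10.2(b)),
the clause `p ≥ 5` of IV.10.2(b) (`hW5`) and Ogg–Saito at the additive places of residue
characteristic `2, 3` (`hW23`). [cite: SilvermanATAEC1994, Thm. IV.10.2 and IV.11.1 (PDF pp. 358–366)] -/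
theorem artinConductorExponent_tate_eq_conductorExponent_of_isElliptic_of_serreTate_of_wild'
    (hST : W.nonempty_fixedSubmodule_inertia_rationalTate_equiv_reductionPoints ℓ)
    (hWm : W.swanConductorAt_rationalTate_eq_zero_of_hasMultiplicativeReductionAt ℓ)
    (hW5 : W.swanConductorAt_rationalTate_eq_zero_of_ringChar_ne ℓ)
    (hW23 : W.swanConductorAt_rationalTate_eq_wildConductorExponent_of_ringChar_eq ℓ) :
    W.artinConductorExponent_tate_eq_conductorExponent_of_isElliptic ℓ :=
  W.artinConductorExponent_tate_eq_conductorExponent_of_isElliptic_of_facts' ℓ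
    (W.codimFixed_inertia_rationalTate_eq_one_of_hasMultiplicativeReductionAt_of_serreTate ℓ hST)
    (W.codimFixed_inertia_rationalTate_eq_two_of_hasAdditiveReductionAt_of_serreTate ℓ hST)
    hWm hW5 hW23

/-- **Semistable curves.**  For a semistable elliptic curve the C15 fact at every `v ∤ ℓ` follows
from Serre–Tate's isomorphism (`hST`) and tameness at the multiplicative places (`hWm`) only.
[cite: SilvermanATAEC1994, Thm. IV.10.2(a),(b) (PDF p. 358)] -/
theorem artinConductorExponent_tate_eq_conductorExponent_of_isSemistable_of_serreTate
    [W.IsElliptic] (hs : W.IsSemistable (𝓞 K))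
    (hST : W.nonempty_fixedSubmodule_inertia_rationalTate_equiv_reductionPoints ℓ)
    (hWm : W.swanConductorAt_rationalTate_eq_zero_of_hasMultiplicativeReductionAt ℓ)
    (h : Continuous fun x : absoluteGaloisGroup K × RationalTateModule (geomPoints W) ℓ ↦
      rationalTateRepresentation (absoluteGaloisGroup K) (geomPoints W) ℓ x.1 x.2)
    (v : HeightOneSpectrum (𝓞 K)) (hℓ : (ℓ : 𝓞 K) ∉ v.asIdeal) :
    conductorExponentOf (geomPoints W) ℓ h v = W.conductorExponent v :=
  W.artinConductorExponent_tate_eq_conductorExponent_of_isSemistable_of_facts ℓ hs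
    (W.codimFixed_inertia_rationalTate_eq_one_of_hasMultiplicativeReductionAt_of_serreTate ℓ hST)
    hWm h v hℓ

end Assembly

end WeierstrassCurve

end
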